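import Summits.ResolutionOfSingularities.ResolutionOfSingularities.Theorems.FrobeniusClosingSteerCore4IsoChartZero
import HarnessLib

/-!
# T1 `chart_zero` in the shape consumed by the Dictionary leaf (`DictT1`, chain W4.1, crux `Steer`)

Topic: `Summits/ResolutionOfSingularities/ResolutionOfSingularities/Theorems`. Companion of
`FrobeniusClosingSteerCore4IsoChartZero` (p478399). res-L0-w41-lead-1's kernel-checked leaf sufficiency
(`stub_core4Dictionary_of_dict : DictT1 → DictT2 → DictI → DictS → Sig.stub_core4Dictionary`, file
`L/res-L0-w41-lead-1/Core4Dictionary-leaf.lean`, DICT-SIGS v3) consumes T1 in the SIMPLIFIED form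

  `DictT1 := ∀ {K} [Field K] (O) {κ} [Field κ] (ι) (p) [Fact p.Prime] [CharP K p] (R) (hR : R ≤ O.toSubring)
    [IsRegularLocalRing R], SubringDominates R O.toSubring → ∀ d, (maximalIdeal R).spanFinrank = d →
    ∃ φ : R →+* MvPowerSeries (Fin d) κ, FC1 O ι R hR φ ∧ FC2 O R hR φ`

(no prescribed image of a parameter, hence also no `x ∈ 𝔪 ∖ 𝔪²` input and `d = 0` allowed). This file proves
exactly that statement, binder for binder, with `FC1`/`FC2`/`centre` inlined: `chart_zero_dict`. Proof = the landed
Cohen construction `ChartZero.exists_ringEquiv_adicCompletion_constantCoeff` on ANY regular system of parameters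
(`exists_regularSystemOfParameters`) followed by the coefficient push-out
`ResidueField R̂ ≅ ResidueField R → ResidueField O → κ` as in `ChartZero.chart_zero`.

OURS (campaign res-hironaka, rung L, slot W4.1); no `Theses.*` / `Cruxes.*` import; replaces the role of no printed
item and is NOT a statement of the manuscript under review [claim: Hironaka2017, status: under-review].
-/

set_option linter.dupNamespace false

noncomputable section

open IsLocalRing Literature.AlgebraicGeometry.Resolution MvPowerSeries

namespace Summit.ResolutionOfSingularities.ResolutionOfSingularities.Theorems.SwitchingDichotomy.ChartZero

/-- **T1 `chart_zero`, Dictionary-leaf shape (`DictT1` of DICT-SIGS v3).** A regular local subring `R ⊆ O` of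
`K` dominated by `O`, `char K = p`, with embedding dimension `d`, has a formal chart `φ : R →+* κ⟦X_1, …, X_d⟧`
whose constant coefficients are the residues in `O` pushed to `κ` (FC1) and under which the centre `𝔪_O ∩ R`
generates `(X_1, …, X_d)` (FC2). [cite: Matsumura1987, Thm. 29.7] -/
theorem chart_zero_dict {K : Type} [Field K] (O : ValuationSubring K) {κ : Type} [Field κ]
    (ι : IsLocalRing.ResidueField O →+* κ)
    (p : ℕ) [Fact p.Prime] [CharP K p] (R : Subring K) (hR : R ≤ O.toSubring)
    [IsRegularLocalRing R] (hdom : SubringDominates R O.toSubring) (d : ℕ)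
    (hd : (IsLocalRing.maximalIdeal R).spanFinrank = d) :
    ∃ φ : R →+* MvPowerSeries (Fin d) κ,
      (∀ r : R, constantCoeff (φ r) = ι (IsLocalRing.residue O (Subring.inclusion hR r))) ∧
      Ideal.map φ (Ideal.comap (Subring.inclusion hR) (IsLocalRing.maximalIdeal O)) =
        Ideal.span (Set.range (X : Fin d → MvPowerSeries (Fin d) κ)) := by
  classical
  -- any regular system of parameters, re-indexed by `Fin d`
  obtain ⟨z₀, hz₀⟩ := exists_regularSystemOfParameters (R := R)
  let z : Fin d → R := z₀ ∘ finCongr hd.symm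
  have hz : Ideal.span (Set.range z) = maximalIdeal R := by
    rw [show Set.range z = Set.range z₀ from (finCongr hd.symm).surjective.range_comp z₀]
    exact hz₀
  -- Cohen coordinates of the completion
  set A := AdicCompletion (maximalIdeal R) R with hA
  obtain ⟨e, heX, hecc⟩ := exists_ringEquiv_adicCompletion_constantCoeff p R hd z hz
  -- the coefficient map `ResidueField R̂ ≅ ResidueField R → ResidueField O → κ`
  let incl : R →+* O := Subring.inclusion hR
  haveI hloc : IsLocalHom incl := isLocalHom_inclusion_of_subringDominates O R hR hdom
  let eRA : ResidueField R ≃+* ResidueField A :=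
    RingEquiv.ofBijective _ (AdicCompletion.residueField_map_bijective R)
  let θR : ResidueField R →+* κ := ι.comp (ResidueField.map incl)
  let θ : ResidueField A →+* κ := θR.comp eRA.symm.toRingHom
  have hθ : ∀ r : R, θ (residue A (algebraMap R A r)) = ι (residue O (incl r)) := by
    intro r
    have h1 : residue A (algebraMap R A r) = eRA (residue R r) := by
      change _ = ResidueField.map (algebraMap R A) (residue R r)
      rw [ResidueField.map_residue]
    change θR (eRA.symm (residue A (algebraMap R A r))) = _
    rw [h1, RingEquiv.symm_apply_apply]
    change ι (ResidueField.map incl (residue R r)) = _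
    rw [ResidueField.map_residue]
  -- the chart
  let φ : R →+* MvPowerSeries (Fin d) κ :=
    (MvPowerSeries.map (σ := Fin d) θ).comp (e.toRingHom.comp (algebraMap R A))
  have hφ : ∀ r : R, φ r = MvPowerSeries.map θ (e (algebraMap R A r)) := fun r => rfl
  -- FC2 bookkeeping: `𝔪_R ↦ 𝔪̂ ↦ (X) ↦ (X)`
  have hmax : maximalIdeal A = (maximalIdeal R).map (algebraMap R A) :=
    AdicCompletion.maximalIdeal_eq_map
  have hz' : Ideal.span (Set.range fun i => algebraMap R A (z i)) = maximalIdeal A := by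
    have h1 : (Ideal.span (Set.range z)).map (algebraMap R A) =
        Ideal.span (Set.range fun i => algebraMap R A (z i)) := by
      rw [Ideal.map_span, ← Set.range_comp]
      rfl
    rw [← h1, hz]
    exact hmax.symm
  have hmapz : Ideal.map e.toRingHom (maximalIdeal A) =
      Ideal.span (Set.range (X : Fin d → MvPowerSeries (Fin d) (ResidueField A))) := by
    rw [← hz', Ideal.map_span, ← Set.range_comp]
    congr 1
    ext F
    constructor
    · rintro ⟨i, rfl⟩
      exact ⟨i, (heX i).symm⟩
    · rintro ⟨i, rfl⟩
      exact ⟨i, heX i⟩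
  have hmapX : Ideal.map (MvPowerSeries.map (σ := Fin d) θ)
      (Ideal.span (Set.range (X : Fin d → MvPowerSeries (Fin d) (ResidueField A)))) =
      Ideal.span (Set.range (X : Fin d → MvPowerSeries (Fin d) κ)) := by
    rw [Ideal.map_span, ← Set.range_comp]
    congr 1
    ext F
    constructor
    · rintro ⟨i, rfl⟩
      exact ⟨i, (MvPowerSeries.map_X θ i).symm⟩
    · rintro ⟨i, rfl⟩
      exact ⟨i, MvPowerSeries.map_X θ i⟩
  refine ⟨φ, fun r => ?_, ?_⟩
  · rw [hφ, MvPowerSeries.constantCoeff_map, hecc, hθ]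
  · rw [comap_maximalIdeal_eq_of_subringDominates O R hR hdom]
    calc Ideal.map φ (maximalIdeal R)
        = Ideal.map (MvPowerSeries.map (σ := Fin d) θ)
            (Ideal.map e.toRingHom (Ideal.map (algebraMap R A) (maximalIdeal R))) := by
          rw [Ideal.map_map, Ideal.map_map]
          rfl
      _ = Ideal.span (Set.range (X : Fin d → MvPowerSeries (Fin d) κ)) := by
          rw [← hmax, hmapz, hmapX]

end Summit.ResolutionOfSingularities.ResolutionOfSingularities.Theorems.SwitchingDichotomy.ChartZero

end
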